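import Summits.HodgeConjecture.HodgeConjecture.Theorems.Ring2AbelianAllAndreDominatedPencils
import Summits.HodgeConjecture.HodgeConjecture.Theorems.Ring2AbelianAllAndreProductPencilsRank
import Literature.AlgebraicGeometry.Motives.AbelianVarietyCohomologyExteriorH1
import HarnessLib

/-!
# Ring 2 · sub-cell AbelianAll (ALL ABELIAN VARIETIES), André axis, part XXXIV-a — ISOGENOUS PENCILS: the André-axis
# statements ASCEND along every surjective `S`-morphism `ψ : 𝒳 ⟶ 𝒳'` of compact pencils of abelian varieties of the same
# relative dimension, so that — with part XXXIII-e's descent — transport and the lift `(L)_t(p)` of `ψ ≫ f'` and of `f'` are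
# EQUIVALENT, point by point and degree by degree: the content of a pencil is an invariant of its fibrewise-isogeny class

HONEST FRAMING (page 1, verbatim): **research route, not a corollary; conditional on HC_CM plus one named
minimal statement.** Cell line: research route conditional on HC_CM; not a corollary; Q11.4-sentence-2 already
refuted in dim ≥ 3. Nothing in this file proves a case of the Hodge conjecture for an abelian variety; `HC_CM`, `HC_AV`
do not occur; no node is born (0 `def`), no named fact is used, no `sorry`; axioms standard; nothing is claimed minimal.

## What this part does (brief (ii): "restrict the class of auxiliary varieties" — up to fibrewise isogeny)

Part XXXIII-e (`Ring2AbelianAllAndreDominatedPencils`) proved the DESCENT `ψ ≫ f' ⟹ f'` of transport and of the lift along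
a surjective `S`-morphism `ψ : 𝒳 ⟶ 𝒳'` of smooth projective families of the same relative dimension, and recorded as NOT
claimed the converse, on the ground that `ψ^* ψ_!` is not a scalar on `H•(𝒳(ℂ))`. It is not; but it IS a scalar MODULO THE
CLASSES DYING ON EVERY FIBRE, and that is all the André axis sees. Precisely:

* §1 (fibres) `complexBetti_map_bijective_of_surjective_of_finrank_eq` — for a surjective morphism `φ : X ⟶ Y` of smooth
  projective varieties of the same dimension, `φ^*` is injective (the tree's degree trick `φ_! φ^* = c • id`, `c ≠ 0`,
  `exists_complexGysin_map_eq_smul_of_surjective`), hence BIJECTIVE in every degree `k` with `b_k(X) = b_k(Y)`; and then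
  **`φ^* φ_! = c • id`** in that degree with the SAME `c` (`exists_map_complexGysin_eq_smul_of_surjective`). For abelian
  varieties of the same dimension `b_k = (2g choose k)` on both sides (the tree's DISCHARGED
  `abelianVarietyCohomologyExteriorH1`, `finrank_complexBetti_eq_of_abelianVariety`).
* §2 (pencils) **`exists_map_fiberι_pull_push_eq_smul`** — for `ψ : 𝒳 ⟶ 𝒳'` surjective over `S` between smooth projective
  families `ψ ≫ f'`, `f'` of the same relative dimension whose fibres at `t` have the same Betti numbers:
  `j_t^*(ψ^* ψ_! W) = C • j_t^* W` for every class `W` of `𝒳`, with ONE scalar `C ≠ 0` — XXXIII-e's base change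
  `j'_t^* ψ_! = c₁ • ψ_{t!} j_t^*`, then §1 on the fibre `ψ_t^* ψ_{t!} = c₂ • id`; `C = c₁ c₂` is read off `W = 1`
  (`ψ_! 1 = c₃ • 1`, `j_t^* 1 = 1 ≠ 0`, part XXXII-d), so `C = c₃ ≠ 0`, the constant of `ψ_! ψ^* = c₃ • id` on the total spaces.
* §3 THE ASCENT ROWS (smooth projective families; hypotheses: equal fibre Betti numbers `hb`, `ψ_s^*` preserves algebraic
  classes on the fibre `hpull` — both discharged for pencils in §4 — and, for the lift only, `ψ^*` preserves algebraic classes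
  on the total spaces `hpullTot`, discharged for locally quasi-finite `ψ`):
  **`comap_le_comap_comp_of_dominant`** — transport from `t` to `s` along `f'` gives transport along `ψ ≫ f'`
  (`W ↦ ψ_! W`: `j'_t^* ψ_! W = c₁ • ψ_{t!}(j_t^* W)` is algebraic, so `j'_s^* ψ_! W` is, so `ψ_s^* j'_s^* ψ_! W = C_s • j_s^* W`
  is, `C_s ≠ 0`); **`comap_le_sup_comp_of_dominant`** — the lift `(L)_t(p)` for `f'` gives `(L)_t(p)` for `ψ ≫ f'`
  (`ψ_! W = η' + κ'` ⟹ `C • W = ψ^* η' + (C • W − ψ^* η')` with `j_t^*(C • W − ψ^* η') = ψ_t^* j'_t^* κ' = 0`).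
* §4 COMPACT PENCILS OF ABELIAN VARIETIES of the same relative dimension `d` and a surjective `S`-morphism `ψ` between them
  (a fibrewise isogeny): `comap_le_comap_comp_of_isogenous`, `forall_map_fiberι_mem_comp_of_isogenous` (NOTHING asked of
  `ψ` but surjectivity), `comap_le_sup_comp_of_isogenous` (`ψ` locally quasi-finite — an isogeny is finite); and with
  XXXIII-e the EQUIVALENCES **`comap_le_comap_iff_of_isogenous`**, **`comap_le_sup_iff_of_isogenous`**,
  `forall_comap_le_sup_iff_of_isogenous`: transport, the lift `(L)_t(p)` and the every-point lift of `ψ ≫ f'` and of `f'`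
  are the same statements, point by point, degree by degree. FACT-FREE.

READING (prose). With XXXIII-a (retracts), XXXIII-e + this part (fibrewise isogenies, now two-sided) and seat b05's finite
étale base change, the André-axis obstruction of a compact pencil `𝒳/S` depends only on the isogeny class of the abelian
scheme `𝒳/S`; in a find-the-cycle problem (the cell's first open cell `(6,3)`, parts XXXII-c / XXXIII-d) the pencil may be
replaced by any isogenous one. Part XXXIV-b adds that `ψ` preserves the CM locus, so the CM-pointed forms agree too.
NOT claimed: that a surjective `S`-morphism of pencils is locally quasi-finite (true, fibrewise an isogeny, but not derived here: an
instance hypothesis of the lift rows); pencils of different relative dimension (XXXIII-a/b); anything minimal; any case of HC. Rows: K.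

References: VoisinHodgeI2002 (§7.3.2 Lemma 7.28, Rem. 7.29); Fulton1998 (Prop. 1.7, Thm. 6.2 (a), §19.2); FultonYoungTableaux1997
(App. B §B.1); LangeBirkenhake1992 (Lemma 1.1.17, Ex. 1.1.6 (8), Prop. 1.2.6); MumfordAV1970 (§1, §19); Milne2020HodgeClassesAV (Prop. 1);
Abdulali1994FamiliesAV ((1.1)); Andre1996Motifs (§6.3, proof of Lemme 6.3.1, p. 32: «bouger s ou t par G(ℚ) change X_s, X_t en des variétés abéliennes isogènes»); DeligneHodgeII1971 (proof of Lemme 4.4.16, p. 53: «remplaçant X par un schéma abélien isogène»); GrothendieckTopology1969 (§1). [Locators revised after REFEREE-AB F-ab-138 / F-ab-142: §5.1 p. 25 of Andre1996Motifs concerns replacing the BASE `S` by a finite étale cover, not the abelian scheme by an isogenous one; the «schéma abélien isogène» sentence is Deligne's.]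
-/

noncomputable section

set_option linter.dupNamespace false

namespace Summit.HodgeConjecture.HodgeConjecture.Ring2.AbelianAll

open CategoryTheory CategoryTheory.Limits AlgebraicGeometry MonoidalCategory CartesianMonoidalCategory
open Literature.AlgebraicGeometry Literature.AlgebraicGeometry.Motives
open Literature.AlgebraicGeometry.HodgeTheory
open Literature.AlgebraicTopology.SingularHomology (singularCohomology)

variable {𝒳 𝒳' S : SchemeOver ℂ}

/-! ## §1 Fibres: the degree trick is two-sided when the Betti numbers agree -/

section Fibres

variable {X Y : SchemeOver ℂ} {n : ℕ} (μ : OrientationFamily) (hX : IsSmoothProjective n X) (hY : IsSmoothProjective n Y)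
  (φ : X ⟶ Y) [Surjective φ.left]

include hX hY in
/-- **`φ^*` is bijective in every degree in which the Betti numbers agree**, for `φ : X ⟶ Y` surjective between smooth
projective varieties of the same dimension: injective by the degree trick (Voisin I, Lemma 7.28 / Remark 7.29, the tree's
`complexBetti_map_injective_of_surjective_of_dim_eq`), hence onto by the dimension count.
[cite: VoisinHodgeI2002, §7.3.2 Lemma 7.28 and Remark 7.29] -/
theorem complexBetti_map_bijective_of_surjective_of_finrank_eq (k : ℕ)
    (hk : Module.finrank ℂ (complexBetti X k) = Module.finrank ℂ (complexBetti Y k)) :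
    Function.Bijective (complexBetti.map φ k) := by
  haveI : Module.Finite ℂ (complexBetti X k) := finite_complexBetti hX k
  haveI : Module.Finite ℂ (complexBetti Y k) := finite_complexBetti hY k
  have hinj : Function.Injective (complexBetti.map φ k) := complexBetti_map_injective_of_surjective_of_dim_eq hX hY φ k
  refine ⟨hinj, ?_⟩
  have h := (LinearMap.injective_iff_surjective_of_finrank_eq_finrank (f := (complexBetti.map φ k).hom) hk.symm).1 hinj
  exact h

include hX hY in
/-- **`φ^* φ_! = c • id` with the constant `c ≠ 0` of `φ_! φ^* = c • id`**, in every degree in which the Betti numbers of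
`X` and `Y` agree (`φ : X ⟶ Y` surjective, smooth projective of the same dimension): every class of `X` is then a pull-back
`φ^* y`, and `φ^* φ_! φ^* y = φ^*(c • y)`. (In print, for an isogeny of abelian varieties, `c = deg φ` and `φ^* φ_* = deg φ`
because the deck translations act trivially on cohomology; here only `c ≠ 0` is proved and needed.)
[cite: VoisinHodgeI2002, §7.3.2 Remark 7.29] [cite: FultonYoungTableaux1997, Appendix B §B.1 (5)–(7)]
[cite: LangeBirkenhake1992, Prop. 1.2.6] -/
theorem exists_map_complexGysin_eq_smul_of_surjective :
    ∃ c : ℂ, c ≠ 0 ∧ ∀ (k : ℕ), Module.finrank ℂ (complexBetti X k) = Module.finrank ℂ (complexBetti Y k) →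
      ∀ (hab : k + 2 * n = k + 2 * n) (x : complexBetti X k),
        complexBetti.map φ k (complexGysin μ hX hY φ hab x) = c • x := by
  obtain ⟨c, hc0, hc⟩ := exists_complexGysin_map_eq_smul_of_surjective μ hX hY φ
  refine ⟨c, hc0, fun k hk hab x ↦ ?_⟩
  obtain ⟨y, rfl⟩ := (complexBetti_map_bijective_of_surjective_of_finrank_eq hX hY φ k hk).2 x
  rw [hc k hab y, map_smul]

/-- **Abelian varieties of the same dimension have the same Betti numbers** on the tree's carriers: through charts
`e : A.X ≅ X`, `e' : A'.X ≅ Y`, `b_k(X) = (2 dim A choose k) = (2 dim A' choose k) = b_k(Y)` (the tree's discharged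
`abelianVarietyCohomologyExteriorH1`: `H• = ⋀• H¹`, `b₁ = 2g`). [cite: LangeBirkenhake1992, Lemma 1.1.17 and Exercise 1.1.6 (8)]
[cite: MumfordAV1970, §1 (3)–(4)] -/
theorem finrank_complexBetti_eq_of_abelianVariety {X Y : SchemeOver ℂ} {A A' : AbelianVariety ℂ} (e : A.X ≅ X)
    (e' : A'.X ≅ Y) (hdim : A.dim = A'.dim) (k : ℕ) :
    Module.finrank ℂ (complexBetti X k) = Module.finrank ℂ (complexBetti Y k) := by
  have hA := abelianVarietyCohomologyExteriorH1.finrank_eq abelianVarietyCohomologyExteriorH1_holds A k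
  have hA' := abelianVarietyCohomologyExteriorH1.finrank_eq abelianVarietyCohomologyExteriorH1_holds A' k
  have eA : complexBetti X k ≃ₗ[ℂ] complexBetti A.X k :=
    LinearEquiv.ofBijective (complexBetti.map e.hom k).hom (complexBetti.bijective_map_of_iso e k)
  have eA' : complexBetti Y k ≃ₗ[ℂ] complexBetti A'.X k :=
    LinearEquiv.ofBijective (complexBetti.map e'.hom k).hom (complexBetti.bijective_map_of_iso e' k)
  rw [eA.finrank_eq, eA'.finrank_eq, hA, hA', hdim]

/-- The fibres at `t` of two compact pencils of abelian varieties of the same relative dimension have the same Betti numbers.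
[cite: LangeBirkenhake1992, Exercise 1.1.6 (8)] [cite: Andre1996Motifs, §6.3 footnote (2)] -/
theorem finrank_complexBetti_fiber_eq_of_pencils {𝒴 : SchemeOver ℂ} {d : ℕ} {f : 𝒳 ⟶ S} {g : 𝒴 ⟶ S}
    (hf : IsCompactAbelianPencil f d) (hg : IsCompactAbelianPencil g d) (t : ComplexPoints S) (k : ℕ) :
    Module.finrank ℂ (complexBetti (fiberOver f t) k) = Module.finrank ℂ (complexBetti (fiberOver g t) k) := by
  obtain ⟨A, ⟨e⟩⟩ := hf.exists_abelianVariety_fiber t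
  obtain ⟨A', ⟨e'⟩⟩ := hg.exists_abelianVariety_fiber t
  exact finrank_complexBetti_eq_of_abelianVariety e e'
    ((Andre1996.compactPencil_dim_eq_of_iso hf e).trans (Andre1996.compactPencil_dim_eq_of_iso hg e').symm) k

end Fibres

/-! ## §2 Pencils: `ψ^* ψ_!` is a non-zero scalar modulo the classes dying on the fibre -/

section Engine

variable {N d : ℕ} {f' : 𝒳' ⟶ S} {ψ : 𝒳 ⟶ 𝒳'} (μ : OrientationFamily) (hX : IsSmoothProjective N 𝒳)
  (hX' : IsSmoothProjective N 𝒳') (hf : IsSmoothProjectiveFamily (ψ ≫ f') d) (hf' : IsSmoothProjectiveFamily f' d)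

variable [IsSeparated S.hom] [Surjective ψ.left]

include hf hf' in
/-- **`j_t^*(ψ^* ψ_! W) = C • j_t^* W` for every class `W` of `𝒳`, with ONE scalar `C ≠ 0`** — for a surjective `S`-morphism
`ψ : 𝒳 ⟶ 𝒳'` of smooth projective families of the same relative dimension whose fibres at `t` have the same Betti numbers.
Base change `j'_t^* ψ_! = c₁ • ψ_{t!} j_t^*` (XXXIII-e, the tree's `complexGysin_cleanBaseChange`), then
`ψ_t^* ψ_{t!} = c₂ • id` on the fibre (§1), `C = c₁ c₂`; and `C ≠ 0` because on `W = 1` the left side is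
`j_t^* ψ^*(c₃ • 1) = c₃ • 1 ≠ 0` (`ψ_! 1 = ψ_! ψ^* 1 = c₃ • 1`, `c₃ ≠ 0`, `1 ≠ 0` in `H⁰` of the fibre). So `ψ^* ψ_!` IS a
scalar modulo `ker j_t^*` — which is all the André axis sees. [cite: Fulton1998, Thm. 6.2 (a) and Example 1.7.4]
[cite: VoisinHodgeI2002, §7.3.2 Remark 7.29] -/
theorem exists_map_fiberι_pull_push_eq_smul (t : ComplexPoints S)
    (hb : ∀ k, Module.finrank ℂ (complexBetti (fiberOver (ψ ≫ f') t) k) = Module.finrank ℂ (complexBetti (fiberOver f' t) k)) :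
    ∃ C : ℂ, C ≠ 0 ∧ ∀ ⦃k : ℕ⦄ (hk : k + 2 * N = k + 2 * N) (W : complexBetti 𝒳 k),
      complexBetti.map (fiberι (ψ ≫ f') t) k (complexBetti.map ψ k (complexGysin μ hX hX' ψ hk W)) =
        C • complexBetti.map (fiberι (ψ ≫ f') t) k W := by
  obtain ⟨c₁, hc₁⟩ := exists_map_fiberι_push_gysin_eq_smul μ hX hX' hf hf' t
  haveI := surjective_fiberOverMap_left f' ψ t
  obtain ⟨c₂, -, hc₂⟩ := exists_map_complexGysin_eq_smul_of_surjective μ (hf.isSmoothProjective t) (hf'.isSmoothProjective t)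
    (fiberOverMap ψ f' t)
  -- the identity with `C = c₂ * c₁`
  have key : ∀ ⦃k : ℕ⦄ (hk : k + 2 * N = k + 2 * N) (W : complexBetti 𝒳 k),
      complexBetti.map (fiberι (ψ ≫ f') t) k (complexBetti.map ψ k (complexGysin μ hX hX' ψ hk W)) =
        (c₁ * c₂) • complexBetti.map (fiberι (ψ ≫ f') t) k W := by
    intro k hk W
    rw [map_fiberι_map_eq, hc₁ hk W, map_smul, hc₂ k (hb k) (by omega), smul_smul]
  refine ⟨c₁ * c₂, ?_, key⟩
  -- non-vanishing: read the identity on `W = 1`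
  obtain ⟨c₃, hc₃0, hc₃⟩ := exists_complexGysin_map_eq_smul_of_surjective μ hX hX' ψ
  have h1 := key (k := 0) rfl (singularCohomology.one ℂ (ComplexPoints 𝒳))
  have hψ1 : complexBetti.map ψ 0 (singularCohomology.one ℂ (ComplexPoints 𝒳')) = singularCohomology.one ℂ (ComplexPoints 𝒳) :=
    singularCohomology.map_one _
  rw [← hψ1, hc₃ 0 rfl, map_smul, map_smul, hψ1, map_fiberι_one] at h1
  intro hC
  rw [hC, zero_smul, smul_eq_zero] at h1
  exact h1.elim hc₃0 (one_fiber_ne_zero μ hf t)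

include hf hf' in
/-- Corollary: **`C • W − ψ^* ψ_! W` dies on `𝒳_t`** for every `W`. [cite: Fulton1998, Thm. 6.2 (a)] -/
theorem exists_sub_map_complexGysin_mem_ker (t : ComplexPoints S)
    (hb : ∀ k, Module.finrank ℂ (complexBetti (fiberOver (ψ ≫ f') t) k) = Module.finrank ℂ (complexBetti (fiberOver f' t) k)) :
    ∃ C : ℂ, C ≠ 0 ∧ ∀ ⦃k : ℕ⦄ (hk : k + 2 * N = k + 2 * N) (W : complexBetti 𝒳 k),
      C • W - complexBetti.map ψ k (complexGysin μ hX hX' ψ hk W) ∈ LinearMap.ker (complexBetti.map (fiberι (ψ ≫ f') t) k).hom := by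
  obtain ⟨C, hC0, hC⟩ := exists_map_fiberι_pull_push_eq_smul μ hX hX' hf hf' t hb
  refine ⟨C, hC0, fun k hk W ↦ ?_⟩
  rw [LinearMap.mem_ker]
  change complexBetti.map (fiberι (ψ ≫ f') t) k (C • W - _) = 0
  rw [map_sub, map_smul, hC hk W, sub_self]

end Engine

/-! ## §3 The ascent rows for smooth projective families -/

section Ascent

variable {N d : ℕ} {f' : 𝒳' ⟶ S} {ψ : 𝒳 ⟶ 𝒳'} (hX : IsSmoothProjective N 𝒳) (hX' : IsSmoothProjective N 𝒳')
  (hf : IsSmoothProjectiveFamily (ψ ≫ f') d) (hf' : IsSmoothProjectiveFamily f' d)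

variable [IsSeparated S.hom] [Surjective ψ.left]

omit [Surjective ψ.left] in
include hX hX' hf hf' in
/-- `ψ_!` maps the classes of `𝒳` algebraic on `𝒳_t` to classes of `𝒳'` algebraic on `𝒳'_t` (`j'_t^* ψ_! W = c₁ • ψ_{t!} j_t^* W`
and Gysin maps preserve algebraic classes). [cite: Fulton1998, Thm. 6.2 (a) and §19.1] -/
theorem complexGysin_mem_comap_of_mem_comap (μ : OrientationFamily) (t : ComplexPoints S) {p : ℕ} {W : complexBetti 𝒳 (2 * p)}
    (hW : W ∈ (algebraicClasses (fiberOver (ψ ≫ f') t) p).comap (complexBetti.map (fiberι (ψ ≫ f') t) (2 * p)).hom) :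
    complexGysin μ hX hX' ψ rfl W ∈ (algebraicClasses (fiberOver f' t) p).comap (complexBetti.map (fiberι f' t) (2 * p)).hom := by
  obtain ⟨c₁, hc₁⟩ := exists_map_fiberι_push_gysin_eq_smul μ hX hX' hf hf' t
  change complexBetti.map (fiberι f' t) (2 * p) (complexGysin μ hX hX' ψ rfl W) ∈ algebraicClasses (fiberOver f' t) p
  rw [hc₁ rfl W]
  exact Submodule.smul_mem _ _ (complexGysin_mem_algebraicClasses_of_mem_algebraicClasses μ (hf.isSmoothProjective t)
    (hf'.isSmoothProjective t) (fiberOverMap ψ f' t) _ hW)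

include hX hX' hf hf' in
/-- **TRANSPORT ASCENDS along a surjective equidimensional `S`-morphism**: if every class of `𝒳'` of degree `2p` algebraic
on `𝒳'_t` is algebraic on `𝒳'_s`, then every class of `𝒳` of degree `2p` algebraic on `𝒳_t` is algebraic on `𝒳_s` —
granted equal fibre Betti numbers at `s` (`hb`) and that `ψ_s^*` preserves algebraic classes (`hpull`; both automatic for
pencils of abelian varieties, §4): `W ↦ ψ_! W`, then `ψ_s^* j'_s^* ψ_! W = j_s^* ψ^* ψ_! W = C_s • j_s^* W`, `C_s ≠ 0`. The converse
of XXXIII-e `comap_le_comap_of_dominant`. FACT-FREE. [cite: Abdulali1994FamiliesAV, (1.1) (p. 1122)]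
[cite: VoisinHodgeI2002, §7.3.2 Remark 7.29] [cite: Fulton1998, Thm. 6.2 (a)] -/
theorem comap_le_comap_comp_of_dominant {t s : ComplexPoints S} {p : ℕ}
    (hb : ∀ k, Module.finrank ℂ (complexBetti (fiberOver (ψ ≫ f') s) k) = Module.finrank ℂ (complexBetti (fiberOver f' s) k))
    (hpull : ∀ y ∈ algebraicClasses (fiberOver f' s) p,
      complexBetti.map (fiberOverMap ψ f' s) (2 * p) y ∈ algebraicClasses (fiberOver (ψ ≫ f') s) p)
    (h : (algebraicClasses (fiberOver f' t) p).comap (complexBetti.map (fiberι f' t) (2 * p)).hom ≤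
      (algebraicClasses (fiberOver f' s) p).comap (complexBetti.map (fiberι f' s) (2 * p)).hom) :
    (algebraicClasses (fiberOver (ψ ≫ f') t) p).comap (complexBetti.map (fiberι (ψ ≫ f') t) (2 * p)).hom ≤
      (algebraicClasses (fiberOver (ψ ≫ f') s) p).comap (complexBetti.map (fiberι (ψ ≫ f') s) (2 * p)).hom := by
  intro W hW
  let μ : OrientationFamily := fun _ _ h ↦ (Motives.ComplexPoints.isOrientableOver ℂ h).some
  obtain ⟨C, hC0, hC⟩ := exists_map_fiberι_pull_push_eq_smul μ hX hX' hf hf' s hb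
  -- `ψ_! W` is algebraic on `𝒳'_t`, hence on `𝒳'_s`
  have hs : complexBetti.map (fiberι f' s) (2 * p) (complexGysin μ hX hX' ψ rfl W) ∈ algebraicClasses (fiberOver f' s) p :=
    h (complexGysin_mem_comap_of_mem_comap hX hX' hf hf' μ t hW)
  -- pull back to `𝒳_s` along `ψ_s`
  have hs' := hpull _ hs
  rw [← map_fiberι_map_eq, hC rfl W] at hs'
  change complexBetti.map (fiberι (ψ ≫ f') s) (2 * p) W ∈ algebraicClasses (fiberOver (ψ ≫ f') s) p
  have := Submodule.smul_mem _ C⁻¹ hs'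
  rwa [smul_smul, inv_mul_cancel₀ hC0, one_smul] at this

include hX hX' hf hf' in
/-- **THE LIFT ASCENDS along a surjective equidimensional `S`-morphism**: `(L)_t(p)` for `f'` gives `(L)_t(p)` for `ψ ≫ f'` —
granted equal fibre Betti numbers at `t` (`hb`) and that `ψ^*` preserves algebraic classes on the total spaces (`hpullTot`,
discharged below for locally quasi-finite `ψ`): for `W` algebraic on `𝒳_t`, `ψ_! W` is algebraic on `𝒳'_t`, so
`ψ_! W = η' + κ'` with `η'` algebraic on `𝒳'` and `κ'` dying on `𝒳'_t`; then `C • W = ψ^* η' + (C • W − ψ^* η')` and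
`j_t^*(C • W − ψ^* η') = j_t^* ψ^* (ψ_! W − η') = ψ_t^* j'_t^* κ' = 0`, `C ≠ 0`. The converse of XXXIII-e
`comap_le_sup_of_dominant`. FACT-FREE. [cite: Milne2020HodgeClassesAV, Prop. 1 (p. 7)] [cite: VoisinHodgeI2002, §7.3.2 Remark 7.29]
[cite: Fulton1998, Thm. 6.2 (a)] -/
theorem comap_le_sup_comp_of_dominant {t : ComplexPoints S} {p : ℕ}
    (hb : ∀ k, Module.finrank ℂ (complexBetti (fiberOver (ψ ≫ f') t) k) = Module.finrank ℂ (complexBetti (fiberOver f' t) k))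
    (hpullTot : ∀ η' ∈ algebraicClasses 𝒳' p, complexBetti.map ψ (2 * p) η' ∈ algebraicClasses 𝒳 p)
    (h : (algebraicClasses (fiberOver f' t) p).comap (complexBetti.map (fiberι f' t) (2 * p)).hom ≤
      algebraicClasses 𝒳' p ⊔ LinearMap.ker (complexBetti.map (fiberι f' t) (2 * p)).hom) :
    (algebraicClasses (fiberOver (ψ ≫ f') t) p).comap (complexBetti.map (fiberι (ψ ≫ f') t) (2 * p)).hom ≤
      algebraicClasses 𝒳 p ⊔ LinearMap.ker (complexBetti.map (fiberι (ψ ≫ f') t) (2 * p)).hom := by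
  intro W hW
  let μ : OrientationFamily := fun _ _ h ↦ (Motives.ComplexPoints.isOrientableOver ℂ h).some
  obtain ⟨C, hC0, hC⟩ := exists_map_fiberι_pull_push_eq_smul μ hX hX' hf hf' t hb
  obtain ⟨η', hη', κ', hκ', hsum⟩ := Submodule.mem_sup.1 (h (complexGysin_mem_comap_of_mem_comap hX hX' hf hf' μ t hW))
  have hCW : C • W = complexBetti.map ψ (2 * p) η' + (C • W - complexBetti.map ψ (2 * p) η') := by abel
  have hmem : C • W ∈ algebraicClasses 𝒳 p ⊔ LinearMap.ker (complexBetti.map (fiberι (ψ ≫ f') t) (2 * p)).hom := by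
    rw [hCW]
    refine Submodule.add_mem_sup (hpullTot _ hη') ?_
    rw [LinearMap.mem_ker] at hκ' ⊢
    change complexBetti.map (fiberι (ψ ≫ f') t) (2 * p) (C • W - complexBetti.map ψ (2 * p) η') = 0
    have hη'eq : η' = complexGysin μ hX hX' ψ rfl W - κ' := by rw [← hsum]; abel
    rw [map_sub, map_smul, ← hC rfl W, hη'eq, map_sub, map_sub, map_fiberι_map_eq (W' := κ')]
    change _ - (_ - complexBetti.map (fiberOverMap ψ f' t) (2 * p) ((complexBetti.map (fiberι f' t) (2 * p)).hom κ')) = 0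
    rw [hκ', map_zero, sub_zero, sub_self]
  have := Submodule.smul_mem _ C⁻¹ hmem
  rwa [smul_smul, inv_mul_cancel₀ hC0, one_smul] at this

include hX hX' hf hf' in
/-- DISCHARGE of `hpullTot` for a locally quasi-finite `ψ` (an isogeny of abelian schemes is finite): the lift ascends.
[cite: GrothendieckTopology1969, §1] [cite: Fulton1998, §19.2 Cor. 19.2 (b) and §1.7] -/
theorem comap_le_sup_comp_of_dominant_of_locallyQuasiFinite [LocallyQuasiFinite ψ.left] {t : ComplexPoints S} {p : ℕ}
    (hb : ∀ k, Module.finrank ℂ (complexBetti (fiberOver (ψ ≫ f') t) k) = Module.finrank ℂ (complexBetti (fiberOver f' t) k))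
    (h : (algebraicClasses (fiberOver f' t) p).comap (complexBetti.map (fiberι f' t) (2 * p)).hom ≤
      algebraicClasses 𝒳' p ⊔ LinearMap.ker (complexBetti.map (fiberι f' t) (2 * p)).hom) :
    (algebraicClasses (fiberOver (ψ ≫ f') t) p).comap (complexBetti.map (fiberι (ψ ≫ f') t) (2 * p)).hom ≤
      algebraicClasses 𝒳 p ⊔ LinearMap.ker (complexBetti.map (fiberι (ψ ≫ f') t) (2 * p)).hom :=
  comap_le_sup_comp_of_dominant hX hX' hf hf' hb (fun _ hη' ↦ map_mem_algebraicClasses_of_locallyQuasiFinite hX hX' ψ hη') h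

include hX hX' hf hf' in
/-- **The single-class transport form ascends**: if every class of `𝒳'` of degree `2p` algebraic on `𝒳'_t` is algebraic on all
fibres of `f'`, then every class of `𝒳` of degree `2p` algebraic on `𝒳_t` is algebraic on all fibres of `ψ ≫ f'` (hypotheses
`hb`, `hpull` at every point). FACT-FREE. [cite: Abdulali1994FamiliesAV, (1.1) (p. 1122)] -/
theorem forall_map_fiberι_mem_comp_of_dominant {t : ComplexPoints S} {p : ℕ}
    (hb : ∀ s k, Module.finrank ℂ (complexBetti (fiberOver (ψ ≫ f') s) k) = Module.finrank ℂ (complexBetti (fiberOver f' s) k))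
    (hpull : ∀ s, ∀ y ∈ algebraicClasses (fiberOver f' s) p,
      complexBetti.map (fiberOverMap ψ f' s) (2 * p) y ∈ algebraicClasses (fiberOver (ψ ≫ f') s) p)
    (h : ∀ U' : complexBetti 𝒳' (2 * p),
      complexBetti.map (fiberι f' t) (2 * p) U' ∈ algebraicClasses (fiberOver f' t) p →
        ∀ s : ComplexPoints S, complexBetti.map (fiberι f' s) (2 * p) U' ∈ algebraicClasses (fiberOver f' s) p)
    (W : complexBetti 𝒳 (2 * p)) (hW : complexBetti.map (fiberι (ψ ≫ f') t) (2 * p) W ∈ algebraicClasses (fiberOver (ψ ≫ f') t) p)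
    (s : ComplexPoints S) : complexBetti.map (fiberι (ψ ≫ f') s) (2 * p) W ∈ algebraicClasses (fiberOver (ψ ≫ f') s) p :=
  comap_le_comap_comp_of_dominant hX hX' hf hf' (t := t) (s := s) (p := p) (hb s) (hpull s) (fun U' hU' ↦ h U' hU' s) hW

end Ascent

/-! ## §4 Compact pencils of abelian varieties: isogenous pencils carry the same André-axis content -/

section Pencils

variable {d : ℕ} {f' : 𝒳' ⟶ S} {ψ : 𝒳 ⟶ 𝒳'} (hf : IsCompactAbelianPencil (ψ ≫ f') d) (hf' : IsCompactAbelianPencil f' d)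

variable [Surjective ψ.left]

include hf hf' in
/-- **TRANSPORT ASCENDS ALONG SURJECTIVE `S`-MORPHISMS OF COMPACT ABELIAN PENCILS of the same relative dimension** (fibrewise
isogenies; nothing but surjectivity is asked of `ψ`): transport from `t` to `s` in degree `2p` along `f'` gives it along
`ψ ≫ f'`. FACT-FREE. [cite: Abdulali1994FamiliesAV, (1.1) (p. 1122)] [cite: Andre1996Motifs, §6.3 proof of Lemme 6.3.1 (p. 32)]
[cite: VoisinHodgeI2002, §7.3.2 Remark 7.29] -/
theorem comap_le_comap_comp_of_isogenous {t s : ComplexPoints S} {p : ℕ}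
    (h : (algebraicClasses (fiberOver f' t) p).comap (complexBetti.map (fiberι f' t) (2 * p)).hom ≤
      (algebraicClasses (fiberOver f' s) p).comap (complexBetti.map (fiberι f' s) (2 * p)).hom) :
    (algebraicClasses (fiberOver (ψ ≫ f') t) p).comap (complexBetti.map (fiberι (ψ ≫ f') t) (2 * p)).hom ≤
      (algebraicClasses (fiberOver (ψ ≫ f') s) p).comap (complexBetti.map (fiberι (ψ ≫ f') s) (2 * p)).hom := by
  haveI : IsProper S.hom := IsSmoothProjective.isProper_holds hf.isSmoothProjective_base
  exact comap_le_comap_comp_of_dominant hf.isSmoothProjective_total hf'.isSmoothProjective_total hf.isSmoothProjectiveFamily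
    hf'.isSmoothProjectiveFamily (finrank_complexBetti_fiber_eq_of_pencils hf hf' s) (pull_of_pencil hf hf' s p) h

include hf hf' in
/-- **TRANSPORT IS AN ISOGENY INVARIANT OF THE PENCIL**: transport from `t` to `s` in degree `2p` holds along `ψ ≫ f'` iff it
holds along `f'` (XXXIII-e `comap_le_comap_of_isogenous` + `comap_le_comap_comp_of_isogenous`). FACT-FREE.
[cite: Abdulali1994FamiliesAV, (1.1) (p. 1122)] [cite: Andre1996Motifs, §6.3 proof of Lemme 6.3.1 (p. 32)] -/
theorem comap_le_comap_iff_of_isogenous (t s : ComplexPoints S) (p : ℕ) :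
    (algebraicClasses (fiberOver (ψ ≫ f') t) p).comap (complexBetti.map (fiberι (ψ ≫ f') t) (2 * p)).hom ≤
        (algebraicClasses (fiberOver (ψ ≫ f') s) p).comap (complexBetti.map (fiberι (ψ ≫ f') s) (2 * p)).hom ↔
      (algebraicClasses (fiberOver f' t) p).comap (complexBetti.map (fiberι f' t) (2 * p)).hom ≤
        (algebraicClasses (fiberOver f' s) p).comap (complexBetti.map (fiberι f' s) (2 * p)).hom :=
  ⟨comap_le_comap_of_isogenous hf hf', comap_le_comap_comp_of_isogenous hf hf'⟩

include hf hf' in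
/-- **The single-class transport form ascends** along a surjective `S`-morphism of compact abelian pencils. FACT-FREE.
[cite: Abdulali1994FamiliesAV, (1.1) (p. 1122)] -/
theorem forall_map_fiberι_mem_comp_of_isogenous {t : ComplexPoints S} {p : ℕ}
    (h : ∀ U' : complexBetti 𝒳' (2 * p),
      complexBetti.map (fiberι f' t) (2 * p) U' ∈ algebraicClasses (fiberOver f' t) p →
        ∀ s : ComplexPoints S, complexBetti.map (fiberι f' s) (2 * p) U' ∈ algebraicClasses (fiberOver f' s) p)
    (W : complexBetti 𝒳 (2 * p)) (hW : complexBetti.map (fiberι (ψ ≫ f') t) (2 * p) W ∈ algebraicClasses (fiberOver (ψ ≫ f') t) p)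
    (s : ComplexPoints S) : complexBetti.map (fiberι (ψ ≫ f') s) (2 * p) W ∈ algebraicClasses (fiberOver (ψ ≫ f') s) p :=
  comap_le_comap_comp_of_isogenous hf hf' (t := t) (s := s) (p := p) (fun U' hU' ↦ h U' hU' s) hW

include hf hf' in
/-- **THE LIFT ASCENDS ALONG SURJECTIVE LOCALLY QUASI-FINITE `S`-MORPHISMS OF COMPACT ABELIAN PENCILS of the same relative
dimension** (fibrewise isogenies, which are finite): `(L)_t(p)` for `f'` gives `(L)_t(p)` for `ψ ≫ f'` (same point, same degree).
FACT-FREE. [cite: Milne2020HodgeClassesAV, Prop. 1 (p. 7)] [cite: Andre1996Motifs, §6.3 proof of Lemme 6.3.1 (p. 32)] [cite: VoisinHodgeI2002, §7.3.2 Remark 7.29] -/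
theorem comap_le_sup_comp_of_isogenous [LocallyQuasiFinite ψ.left] {t : ComplexPoints S} {p : ℕ}
    (h : (algebraicClasses (fiberOver f' t) p).comap (complexBetti.map (fiberι f' t) (2 * p)).hom ≤
      algebraicClasses 𝒳' p ⊔ LinearMap.ker (complexBetti.map (fiberι f' t) (2 * p)).hom) :
    (algebraicClasses (fiberOver (ψ ≫ f') t) p).comap (complexBetti.map (fiberι (ψ ≫ f') t) (2 * p)).hom ≤
      algebraicClasses 𝒳 p ⊔ LinearMap.ker (complexBetti.map (fiberι (ψ ≫ f') t) (2 * p)).hom := by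
  haveI : IsProper S.hom := IsSmoothProjective.isProper_holds hf.isSmoothProjective_base
  exact comap_le_sup_comp_of_dominant_of_locallyQuasiFinite hf.isSmoothProjective_total hf'.isSmoothProjective_total
    hf.isSmoothProjectiveFamily hf'.isSmoothProjectiveFamily (finrank_complexBetti_fiber_eq_of_pencils hf hf' t) h

include hf hf' in
/-- **THE LIFT IS AN ISOGENY INVARIANT OF THE PENCIL**: `(L)_t(p)` holds for `ψ ≫ f'` iff it holds for `f'`, for a surjective
locally quasi-finite `S`-morphism `ψ` of compact abelian pencils of the same relative dimension (XXXIII-e `comap_le_sup_of_isogenous`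
+ `comap_le_sup_comp_of_isogenous`). FACT-FREE. [cite: Milne2020HodgeClassesAV, Prop. 1 (p. 7)] [cite: Andre1996Motifs, §6.3 proof of Lemme 6.3.1 (p. 32)] -/
theorem comap_le_sup_iff_of_isogenous [LocallyQuasiFinite ψ.left] (t : ComplexPoints S) (p : ℕ) :
    (algebraicClasses (fiberOver (ψ ≫ f') t) p).comap (complexBetti.map (fiberι (ψ ≫ f') t) (2 * p)).hom ≤
        algebraicClasses 𝒳 p ⊔ LinearMap.ker (complexBetti.map (fiberι (ψ ≫ f') t) (2 * p)).hom ↔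
      (algebraicClasses (fiberOver f' t) p).comap (complexBetti.map (fiberι f' t) (2 * p)).hom ≤
        algebraicClasses 𝒳' p ⊔ LinearMap.ker (complexBetti.map (fiberι f' t) (2 * p)).hom :=
  ⟨comap_le_sup_of_isogenous hf hf', comap_le_sup_comp_of_isogenous hf hf'⟩

include hf hf' in
/-- **The every-point lift (the pencil's share of `AlgebraicFixedPart`) is an isogeny invariant**: `(L)_t(p)` at every `t` for
`ψ ≫ f'` iff at every `t` for `f'`. FACT-FREE. [cite: Milne2020HodgeClassesAV, Prop. 1 (p. 7)] -/
theorem forall_comap_le_sup_iff_of_isogenous [LocallyQuasiFinite ψ.left] (p : ℕ) :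
    (∀ t : ComplexPoints S, (algebraicClasses (fiberOver (ψ ≫ f') t) p).comap (complexBetti.map (fiberι (ψ ≫ f') t) (2 * p)).hom ≤
        algebraicClasses 𝒳 p ⊔ LinearMap.ker (complexBetti.map (fiberι (ψ ≫ f') t) (2 * p)).hom) ↔
      ∀ t : ComplexPoints S, (algebraicClasses (fiberOver f' t) p).comap (complexBetti.map (fiberι f' t) (2 * p)).hom ≤
        algebraicClasses 𝒳' p ⊔ LinearMap.ker (complexBetti.map (fiberι f' t) (2 * p)).hom :=
  forall_congr' fun t ↦ comap_le_sup_iff_of_isogenous hf hf' t p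

include hf hf' in
/-- **The every-point transport (the pencil's share of the variational statements (2)/(3)) is an isogeny invariant**: "every
class of degree `2p` algebraic on one fibre is algebraic on all fibres" holds for `ψ ≫ f'` iff for `f'`. FACT-FREE.
[cite: Abdulali1994FamiliesAV, (1.1) (p. 1122)] -/
theorem forall_comap_le_comap_iff_of_isogenous (p : ℕ) :
    (∀ t s : ComplexPoints S, (algebraicClasses (fiberOver (ψ ≫ f') t) p).comap (complexBetti.map (fiberι (ψ ≫ f') t) (2 * p)).hom ≤
        (algebraicClasses (fiberOver (ψ ≫ f') s) p).comap (complexBetti.map (fiberι (ψ ≫ f') s) (2 * p)).hom) ↔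
      ∀ t s : ComplexPoints S, (algebraicClasses (fiberOver f' t) p).comap (complexBetti.map (fiberι f' t) (2 * p)).hom ≤
        (algebraicClasses (fiberOver f' s) p).comap (complexBetti.map (fiberι f' s) (2 * p)).hom :=
  forall_congr' fun t ↦ forall_congr' fun s ↦ comap_le_comap_iff_of_isogenous hf hf' t s p

end Pencils

end Summit.HodgeConjecture.HodgeConjecture.Ring2.AbelianAll

end
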